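import Summits.Ventures.CertifiedManyBodySolver.Observables.StiffnessApexTransportTargetSlot
import Summits.Ventures.CertifiedManyBodySolver.Observables.StiffnessApexTransportStem
import HarnessLib

/-!
# Ventures/CertifiedManyBodySolver — Observables/StiffnessApexTransportStemDoped.lean

HONEST FRAMING: one-sided certified CEILINGS on the uniform flux stiffness (`t–t′` f-sum class) at ANY density `0 ≤ n < 2`, TRANSPORTED from
sources on ONE VERTICAL LINE `t′ = p` read at the TARGET's hopping slot; a ceiling never speaks to the presence of order; not a `T_c` estimate,
not a superconductivity verdict; every leaf is CONDITIONAL on the row family it names. Zero compute, no definition, no claim node, no `sorry`.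

Cell `pub/hubbard-downfold` (D-0150 L-DF2 «box ↦ one word»), seat `hubbard-downfold-unc-2` (`prover-hubbard-downfold-unc-2-g17-0`); the
any-density twin of `Observables/StiffnessApexTransportStem.lean` (half filling, own words) on the engine of
`Observables/StiffnessApexTransportTargetSlot.lean` (`ObsStiffnessSeqCeilingAt_of_apexSource_targetSlot_orbitLower`: a source on the apex segment
of the target, read at the slot `σ = t′_P`, words the target at any density — NO lever, NO `K₂` word).

THE POINT. Away from half filling the free half `t′K₂ ≤ 0` is gone, so a stem source `(p, U′)` must be read at the TARGET slot `σ = t′` of each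
target it serves; the targets of `(p, U′)` inside a box `[p, q] × [·, U_max]` have `t′ ∈ [p/(2 − U′/U_max), q] ∩ [p, q]`, so each stem source
carries a σ-INTERVAL of reads — two END-objective reads + the σ-chord (`orbitLower_slot_chord_of_two_endObjectives`, companion TargetSlot §5),
exactly the «PatchLeftEdge» shape of the Hg-1201 / NdNiO₂ coverage routes. With that reading the stem theorems of the companion go through
verbatim at any density:

* §1 `ObsStiffnessSeqCeilingAt_of_leftLine_targetSlot_orbitLower` — point form: family `valL σ U′` on slots `σ ∈ [σ₁, σ₂]` × stem
  `U′ ∈ [U₀, U_L]` words every target `(t′, U)` with `p ≤ t′ < 0`, `t′ ∈ [σ₁, σ₂]`, `U₀ ≤ U(2 − p/t′) ≤ U_L`;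
* §2 `ObsStiffnessSeqCeilingAt_on_box_of_leftStem_targetSlot` — the «I» edition at density `n`: slots `σ ∈ [p, q]`, stem `[U₀, U_L]` with
  `U₀ ≤ U_A(2 − p/q)`, `U_max ≤ U_L` ⇒ the whole box `[p, q] × [U_A, U_max]` (foot below the box; no bottom bundle, no overhang);
  `…_on_box3_of_leftStem_targetSlot` — the same over a density interval `[n₁, n₂]` (3-D material boxes);
  `ObsStiffnessSeqCeilingAt_above_station_of_leftLine_targetSlot` — the stem on `[U_S, U_L]` words the station-`U_S` transport shadow.

PLANNING NOTE [float]: for the patch routes the foot that replaces the bottom `t′`-bundle is `U₀ = U_A(2 − p/q_patch)`: Hg-1201 M19b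
(`p = −27/50`, `q_patch = −13/25`, `U_A = 7/2`) `3.365`; M19P10 (`−49/100`, `−47/100`, `3`) `2.872`; NdNiO₂ M21 (`−23/50`, `−11/25`, `5`) `4.773`;
La214 M2(c) with the kinematic slab `t′ ≥ −6/25` (`p = −3/10`, `U_A = 29/5`) `4.35`. Which object is cheaper is the captains' call.

References: T. Koma, H. Tasaki, J. Stat. Phys. 76 (1994) 745, §1 [KomaTasaki1994]; D. J. Scalapino, S. R. White, S.-C. Zhang, PRB 47 (1993)
7995, §II [ScalapinoWhiteZhang1993].
-/

noncomputable section

namespace Summit.Ventures.CertifiedManyBodySolver.Observables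

open Literature.MathematicalPhysics.QuantumLattice
open Literature.MathematicalPhysics.QuantumLattice.ThermodynamicLimit
open Literature.MathematicalPhysics.QuantumFieldTheory
open Literature.Probability.LatticeModels
open Matrix Finset Filter Topology HubbardWave0
open scoped Matrix BigOperators ComplexOrder

section StemDoped

variable {p q UA Umax U₀ UL US σ₁ σ₂ n n₁ n₂ : ℝ}

/-- **Left-line (stem) transport at any density, point form.** A target-slot orbit-lower family `valL σ U′` on slots `σ ∈ [σ₁, σ₂]` and the stem
`{p} × [U₀, U_L]` (`0 ≤ U₀`), density `0 ≤ n < 2`: for every such `(σ, U′)`, every torus limit of unit `(rectN n L, S^z = 0)`-sector ground states of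
`hubbardTorusTT' L 1 p U′` has `valL σ U′ ≤ |D₄|⁻¹ Σ_γ Re ω(Γ_γ(−X₀(σ, U′)))`, with `−valL σ U′ ≤ c`. Then every target `(t′, U)` with `p ≤ t′ < 0`,
`t′ ∈ [σ₁, σ₂]`, `0 < U`, `U₀ ≤ U(2 − p/t′) ≤ U_L` carries `ObsStiffnessSeqCeilingAt t′ U n c` (source `(p, U(2 − p/t′))` read at the slot `t′`).
[cite: KomaTasaki1994, §1] [cite: ScalapinoWhiteZhang1993, §II] -/
theorem ObsStiffnessSeqCeilingAt_of_leftLine_targetSlot_orbitLower (hU₀ : 0 ≤ U₀) (hn0 : 0 ≤ n) (hn2 : n < 2) (valL : ℝ → ℝ → ℝ) (c : ℚ)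
    (hL : ∀ σ ∈ Set.Icc σ₁ σ₂, ∀ U' ∈ Set.Icc U₀ UL,
      ∀ (ω : InfVolFermionState 2) (Ls : ℕ → ℕ) (ψ : ∀ L, Fock (Orb (FermionTorus 2 L))),
      Tendsto Ls atTop atTop →
      (∀ j, IsGroundStateInSector (hubbardTorusTT' (Ls j) 1 p U') (rectN n (Ls j)) 0 (ψ (Ls j))) →
      (∀ j, star (ψ (Ls j)) ⬝ᵥ ψ (Ls j) = 1) → ω.IsTorusLimitOf ψ Ls →
      valL σ U' ≤ ((Finset.univ : Finset (DihedralGroup 4)).card : ℝ)⁻¹ * ∑ g ∈ (Finset.univ : Finset (DihedralGroup 4)),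
        (ω.expect (d4ShiftSet g 0 (box 2 7)) (fermionEmbed (PolySite.d4Emb g 0 (box 2 7)) (-oddMomentObsTT σ U' 0))).re)
    (hcL : ∀ σ ∈ Set.Icc σ₁ σ₂, ∀ U' ∈ Set.Icc U₀ UL, -valL σ U' ≤ ((c : ℚ) : ℝ))
    {tp U : ℝ} (htp : p ≤ tp) (ht0 : tp < 0) (hσ : tp ∈ Set.Icc σ₁ σ₂) (hU : 0 < U) (h₀ : U₀ ≤ U * (2 - p / tp))
    (h₁ : U * (2 - p / tp) ≤ UL) : ObsStiffnessSeqCeilingAt tp U n c := by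
  obtain ⟨hU'le, hapex⟩ := leftEdge_apexSource htp ht0 hU
  have hmem : U * (2 - p / tp) ∈ Set.Icc U₀ UL := ⟨h₀, h₁⟩
  exact ObsStiffnessSeqCeilingAt_of_apexSource_targetSlot_orbitLower (U * (2 - p / tp)) (valL tp (U * (2 - p / tp))) (hU₀.trans h₀)
    hU'le hU hapex hn0 hn2 (hL tp hσ _ hmem) c (hcL tp hσ _ hmem)

/-- **THE STEM THEOREM AT DENSITY `n`: ONE VERTICAL LINE, READ AT THE TARGET SLOTS, WORDS A BOX.** Box `[p, q] × [U_A, U_max]`, `p ≤ q < 0 < U_A`,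
`0 ≤ n < 2`. A target-slot family `valL σ U′` on `σ ∈ [p, q]`, `U′ ∈ [U₀, U_L]` with `0 ≤ U₀ ≤ U_A(2 − p/q)`, `U_max ≤ U_L`, priced `−valL ≤ c`, gives
`ObsStiffnessSeqCeilingAt t′ U n c` at every point of the box. No bottom bundle, no overhang, no lever, no `K₂` word.
[cite: KomaTasaki1994, §1] [cite: ScalapinoWhiteZhang1993, §II] -/
theorem ObsStiffnessSeqCeilingAt_on_box_of_leftStem_targetSlot (hpq : p ≤ q) (hq : q < 0) (hUA : 0 < UA) (hU₀ : 0 ≤ U₀)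
    (hfoot : U₀ ≤ UA * (2 - p / q)) (htop : Umax ≤ UL) (hn0 : 0 ≤ n) (hn2 : n < 2) (valL : ℝ → ℝ → ℝ) (c : ℚ)
    (hL : ∀ σ ∈ Set.Icc p q, ∀ U' ∈ Set.Icc U₀ UL,
      ∀ (ω : InfVolFermionState 2) (Ls : ℕ → ℕ) (ψ : ∀ L, Fock (Orb (FermionTorus 2 L))),
      Tendsto Ls atTop atTop →
      (∀ j, IsGroundStateInSector (hubbardTorusTT' (Ls j) 1 p U') (rectN n (Ls j)) 0 (ψ (Ls j))) →
      (∀ j, star (ψ (Ls j)) ⬝ᵥ ψ (Ls j) = 1) → ω.IsTorusLimitOf ψ Ls →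
      valL σ U' ≤ ((Finset.univ : Finset (DihedralGroup 4)).card : ℝ)⁻¹ * ∑ g ∈ (Finset.univ : Finset (DihedralGroup 4)),
        (ω.expect (d4ShiftSet g 0 (box 2 7)) (fermionEmbed (PolySite.d4Emb g 0 (box 2 7)) (-oddMomentObsTT σ U' 0))).re)
    (hcL : ∀ σ ∈ Set.Icc p q, ∀ U' ∈ Set.Icc U₀ UL, -valL σ U' ≤ ((c : ℚ) : ℝ)) :
    ∀ tp ∈ Set.Icc p q, ∀ U ∈ Set.Icc UA Umax, ObsStiffnessSeqCeilingAt tp U n c := by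
  intro tp htp U hU
  have _ := hpq
  have ht0 : tp < 0 := lt_of_le_of_lt htp.2 hq
  have hU0 : 0 < U := hUA.trans_le hU.1
  have h2 : 0 ≤ 2 - p / q := by
    by_contra h
    have := mul_neg_of_pos_of_neg hUA (not_le.mp h)
    linarith
  obtain ⟨hlo, hhi⟩ := leftLine_source_mem_Icc (p := p) hq h2 htp hUA hU
  exact ObsStiffnessSeqCeilingAt_of_leftLine_targetSlot_orbitLower hU₀ hn0 hn2 valL c hL hcL htp.1 ht0 htp hU0 (hfoot.trans hlo)
    (hhi.trans htop)

/-- **THE STEM OVER A DENSITY INTERVAL (3-D material boxes).** Box `[p, q] × [U_A, U_max] × [n₁, n₂]`, `p ≤ q < 0 < U_A`, `0 ≤ n₁`, `n₂ < 2`: a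
target-slot family `valL x σ U′` per density `x ∈ [n₁, n₂]` on `σ ∈ [p, q]`, `U′ ∈ [U₀, U_L]` (`0 ≤ U₀ ≤ U_A(2 − p/q)`, `U_max ≤ U_L`), priced `≤ c`,
gives `ObsStiffnessSeqCeilingAt t′ U x c` on the whole 3-D box. [cite: KomaTasaki1994, §1] [cite: ScalapinoWhiteZhang1993, §II] -/
theorem ObsStiffnessSeqCeilingAt_on_box3_of_leftStem_targetSlot (hpq : p ≤ q) (hq : q < 0) (hUA : 0 < UA) (hU₀ : 0 ≤ U₀)
    (hfoot : U₀ ≤ UA * (2 - p / q)) (htop : Umax ≤ UL) (hn₁ : 0 ≤ n₁) (hn₂ : n₂ < 2) (valL : ℝ → ℝ → ℝ → ℝ) (c : ℚ)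
    (hL : ∀ x ∈ Set.Icc n₁ n₂, ∀ σ ∈ Set.Icc p q, ∀ U' ∈ Set.Icc U₀ UL,
      ∀ (ω : InfVolFermionState 2) (Ls : ℕ → ℕ) (ψ : ∀ L, Fock (Orb (FermionTorus 2 L))),
      Tendsto Ls atTop atTop →
      (∀ j, IsGroundStateInSector (hubbardTorusTT' (Ls j) 1 p U') (rectN x (Ls j)) 0 (ψ (Ls j))) →
      (∀ j, star (ψ (Ls j)) ⬝ᵥ ψ (Ls j) = 1) → ω.IsTorusLimitOf ψ Ls →
      valL x σ U' ≤ ((Finset.univ : Finset (DihedralGroup 4)).card : ℝ)⁻¹ * ∑ g ∈ (Finset.univ : Finset (DihedralGroup 4)),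
        (ω.expect (d4ShiftSet g 0 (box 2 7)) (fermionEmbed (PolySite.d4Emb g 0 (box 2 7)) (-oddMomentObsTT σ U' 0))).re)
    (hcL : ∀ x ∈ Set.Icc n₁ n₂, ∀ σ ∈ Set.Icc p q, ∀ U' ∈ Set.Icc U₀ UL, -valL x σ U' ≤ ((c : ℚ) : ℝ)) :
    ∀ tp ∈ Set.Icc p q, ∀ U ∈ Set.Icc UA Umax, ∀ x ∈ Set.Icc n₁ n₂, ObsStiffnessSeqCeilingAt tp U x c :=
  fun tp htp U hU x hx =>
    ObsStiffnessSeqCeilingAt_on_box_of_leftStem_targetSlot hpq hq hUA hU₀ hfoot htop (hn₁.trans hx.1) (lt_of_le_of_lt hx.2 hn₂)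
      (valL x) c (hL x hx) (hcL x hx) tp htp U hU

/-- **THE STEM ABOVE A STATION WORDS THE STATION'S TRANSPORT SHADOW, ANY DENSITY.** A target-slot family `valL σ U′` on `σ ∈ [σ₁, σ₂]`,
`U′ ∈ [U_S, U_L]` (`0 ≤ U_S`), density `0 ≤ n < 2`, priced `≤ c`: every target `(t′, U)` with `p ≤ t′ < 0`, `t′ ∈ [σ₁, σ₂]`, `0 < U`, station-`U_S`
source `t′(2U − U_S)/U ≤ p` and stem source `U(2 − p/t′) ≤ U_L` carries `ObsStiffnessSeqCeilingAt t′ U n c`.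
[cite: KomaTasaki1994, §1] [cite: ScalapinoWhiteZhang1993, §II] -/
theorem ObsStiffnessSeqCeilingAt_above_station_of_leftLine_targetSlot (hUS : 0 ≤ US) (hn0 : 0 ≤ n) (hn2 : n < 2)
    (valL : ℝ → ℝ → ℝ) (c : ℚ)
    (hL : ∀ σ ∈ Set.Icc σ₁ σ₂, ∀ U' ∈ Set.Icc US UL,
      ∀ (ω : InfVolFermionState 2) (Ls : ℕ → ℕ) (ψ : ∀ L, Fock (Orb (FermionTorus 2 L))),
      Tendsto Ls atTop atTop →
      (∀ j, IsGroundStateInSector (hubbardTorusTT' (Ls j) 1 p U') (rectN n (Ls j)) 0 (ψ (Ls j))) →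
      (∀ j, star (ψ (Ls j)) ⬝ᵥ ψ (Ls j) = 1) → ω.IsTorusLimitOf ψ Ls →
      valL σ U' ≤ ((Finset.univ : Finset (DihedralGroup 4)).card : ℝ)⁻¹ * ∑ g ∈ (Finset.univ : Finset (DihedralGroup 4)),
        (ω.expect (d4ShiftSet g 0 (box 2 7)) (fermionEmbed (PolySite.d4Emb g 0 (box 2 7)) (-oddMomentObsTT σ U' 0))).re)
    (hcL : ∀ σ ∈ Set.Icc σ₁ σ₂, ∀ U' ∈ Set.Icc US UL, -valL σ U' ≤ ((c : ℚ) : ℝ))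
    {tp U : ℝ} (htp : p ≤ tp) (ht0 : tp < 0) (hσ : tp ∈ Set.Icc σ₁ σ₂) (hU : 0 < U) (hs : tp * (2 * U - US) / U ≤ p)
    (h₁ : U * (2 - p / tp) ≤ UL) : ObsStiffnessSeqCeilingAt tp U n c :=
  ObsStiffnessSeqCeilingAt_of_leftLine_targetSlot_orbitLower hUS hn0 hn2 valL c hL hcL htp ht0 hσ hU
    (station_le_leftLine_source_of_stationSource_le ht0 hU hs) h₁

end StemDoped

end Summit.Ventures.CertifiedManyBodySolver.Observables

end
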